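import Literature.NumberTheory.EllipticCurves.SpectralValuationUnramified
import Literature.NumberTheory.EllipticCurves.ReductionInertiaInvarianceProofs
import Literature.NumberTheory.DiophantineGeometry.TateAlgorithmLocal
import Mathlib.RingTheory.DiscreteValuationRing.Basic
import HarnessLib

/-!
# The valuation ring `𝒪ⁿʳ` of the maximal unramified extension `K_v^nr ⊆ K̄_v`:
# a henselian discrete valuation ring, unramified over `𝓞_v`

`Proofs` file (theorems only, no definitions, no named facts) in topic
`NumberTheory/EllipticCurves`, landed by the tenured seat of bsd.S15
(`Literature.NumberTheory.EllipticCurves.conductorNorm_eq_artinConductorNat`, `BSDConductor`).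
First of the files proving the Kodaira–Néron finiteness over `K_v^nr`
(`WeierstrassCurve.kodairaNeron_exists_finset_reducesToNonsingular`, `KodairaNeronUnramified`;
Silverman, *AEC*, Cor. VII.6.2 as used in the proof of Thm. VII.7.1) at the places of **additive**
reduction, by transporting the normal forms of Tate's algorithm from `𝓞_v` to the valuation ring
of `K_v^nr` and applying there the elementary computations of the local index
(`NeronComponentIndexType*Proofs`, Silverman, *ATAEC*, IV.9.4), which are stated over an arbitrary
henselian discrete valuation ring.  This file supplies the ring.

Let `K` be a number field, `v` a finite place, `K_v` the completion, `K̄_v` an algebraic closure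
with its spectral valuation `w = |·|_v` (`hw`), `K_v^nr = maxUnramified K_v ⊆ K̄_v` the maximal
unramified extension of the tree (`UnramifiedKummer`, `KodairaNeronUnramifiedInertiaProofs`: the
fixed field of the inertia group `I_𝔐`, `mem_maxUnramified_iff_forall_inertia`), and
`𝒪ⁿʳ = {x ∈ K_v^nr : |x|_v ≤ 1}` its valuation ring — written throughout as the *expression*
`(w.comap (algebraMap K_v^nr K̄_v)).valuationSubring` (Mathlib `Valuation.valuationSubring`; no
definition is introduced; `𝒪ⁿʳ` in this docstring).  We prove:

* `isDiscreteValuationRing_unrIntegers` — **`𝒪ⁿʳ` is a discrete valuation ring** with the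
  uniformiser of `𝓞_v` as uniformiser (`irreducible_unrIntegers_of_coe_eq`,
  `exists_eq_pow_mul_unit_unrIntegers`): the value group of `K_v^nr` is that of `K_v` (Neukirch,
  *ANT*, II (7.5) with (9.11); tree `exists_spectralValuation_eq_pow_of_forall_inertia`);
  `mem_maximalIdeal_unrIntegers_pow_iff`: `x ∈ 𝔪ᵏ ↔ |x|_v ≤ |ϖ|ᵏ`;
* `henselianLocalRing_unrIntegers` — **`𝒪ⁿʳ` is henselian**: a simple root modulo `𝔪` of a monic
  polynomial lifts to the (henselian, `henselianLocalRing_integer`) valuation ring of `K̄_v`, and the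
  lift lies in `K_v^nr` because its `I_𝔐`-conjugates are roots congruent to it, hence equal to it
  by the uniqueness half of Hensel's lemma (`eq_of_isRoot_of_sub_mem_maximalIdeal`,
  `mem_maxUnramified_of_isRoot_map`) — Neukirch, *ANT*, II §6;
* `exists_ringHom_adicCompletionIntegers_unrIntegers` and the **transfer lemmas** along the
  structure map `φ : 𝓞_v → 𝒪ⁿʳ`: `map_mem_maximalIdeal_pow_iff` (`φ a ∈ 𝔪ᵏ ↔ a ∈ 𝓂_vᵏ`: the
  extension `𝒪ⁿʳ/𝓞_v` is unramified), `map_mem_maximalIdeal_iff`, `isUnit_map_iff`,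
  `injective_of_coe_eq_algebraMap`, `irreducible_map_of_coe_eq_algebraMap`; and the embedding
  `ψ : 𝒪ⁿʳ → 𝒪_w` into the valuation ring of `K̄_v` (`exists_ringHom_unrIntegers_integer`,
  `map_mem_maximalIdeal_integer_iff`, `injective_of_coe_eq_coe`).

## References

* J. Neukirch, *Algebraic Number Theory*, Springer 1999, Ch. II (4.6), §6 (henselian fields),
  Prop. (7.5), Def. (9.10), Prop. (9.11). [NeukirchANT1999]
* J. H. Silverman, *The Arithmetic of Elliptic Curves*, 2nd ed. (2009), VII.§4–§6 (`K^nr`,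
  Cor. VII.6.2, proof of Thm. VII.7.1). [SilvermanAEC2009]

## Design

No definitions; `noncomputable section`; `open scoped Classical NNReal`; one universe `u`; the
spectral valuation is quantified with its defining property `hw` as in `SelmerFiniteProofs`.
In the docstrings `Kᵥ`, `K̄ᵥ`, `Kⁿʳ`, `wⁿʳ`, `𝒪ⁿʳ` abbreviate the expressions above, which the
code spells out (no notation is declared).  Lemmas taking polynomials over `𝒪ⁿʳ` are stated over an
arbitrary coefficient ring `S` mapping to `𝒪_w` (`mem_maxUnramified_of_isRoot_map`) so that the
instance path of `S[X]` is the caller's.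
-/

noncomputable section

open scoped Classical NNReal
open NumberField IsDedekindDomain Field Polynomial

universe u

namespace IsDedekindDomain.HeightOneSpectrum

open Literature.NumberTheory.EllipticCurves Literature.NumberTheory.GaloisRepresentations
  Literature.NumberTheory.GaloisRepresentations.IsNonarchimedeanLocalField
  Literature.NumberTheory.DiophantineGeometry.TateAlgorithm

variable {K : Type u} [Field K] [NumberField K] {v : HeightOneSpectrum (𝓞 K)}
  {w : Valuation (AlgebraicClosure (v.adicCompletion K)) ℝ≥0}
  (hw : ∀ x, (w x : ℝ) = spectralNorm (v.adicCompletion K) (AlgebraicClosure (v.adicCompletion K)) x)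


/-- The restricted valuation on `K_v^nr` is `w` (by definition). [folklore] -/
theorem comap_maxUnramified_apply (x : (maxUnramified (v.adicCompletion K))) : ((Valuation.comap (algebraMap (maxUnramified (v.adicCompletion K)) (AlgebraicClosure (v.adicCompletion K))) w)) x = w (x : (AlgebraicClosure (v.adicCompletion K))) := rfl

/-- Elements of `𝒪ⁿʳ` have `w`-value `≤ 1` (by definition). [folklore] -/
theorem coe_unrIntegers_le_one (x : (Valuation.valuationSubring (Valuation.comap (algebraMap (maxUnramified (v.adicCompletion K)) (AlgebraicClosure (v.adicCompletion K))) w))) : w ((x : (maxUnramified (v.adicCompletion K))) : (AlgebraicClosure (v.adicCompletion K))) ≤ 1 := x.2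

include hw in
/-- Elements of `K_v^nr` are fixed by the inertia group `I_𝔐` (`mem_maxUnramified_iff_forall_inertia`).
[cite: NeukirchANT1999, Ch. II Prop. (9.11)] -/
theorem smul_coe_maxUnramified {𝔐 : Ideal v.localAbsIntegers} (h𝔐 : 𝔐 ∈ v.localPrimesAbove)
    (x : (maxUnramified (v.adicCompletion K))) {σ : absoluteGaloisGroup (v.adicCompletion K)} (hσ : σ ∈ 𝔐.inertia (absoluteGaloisGroup (v.adicCompletion K))) :
    absoluteGaloisGroup.toAlgEquiv (v.adicCompletion K) σ (x : (AlgebraicClosure (v.adicCompletion K))) = x :=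
  (mem_maxUnramified_iff_forall_inertia hw h𝔐).mp x.2 σ hσ


/-- The coercion `𝒪ⁿʳ → K̄ᵥ` is injective on zero: `x ≠ 0 → (x : K̄ᵥ) ≠ 0`. [folklore] -/
theorem coe_coe_unrIntegers_ne_zero {x : (Valuation.valuationSubring (Valuation.comap (algebraMap (maxUnramified (v.adicCompletion K)) (AlgebraicClosure (v.adicCompletion K))) w))} (hx : x ≠ 0) : ((x : (maxUnramified (v.adicCompletion K))) : (AlgebraicClosure (v.adicCompletion K))) ≠ 0 := by
  intro h
  apply hx
  have h1 : (x : (maxUnramified (v.adicCompletion K))) = 0 := by exact_mod_cast h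
  exact_mod_cast h1

/-- Units of `𝒪ⁿʳ` are the elements of `w`-value `1`. [folklore] -/
theorem isUnit_unrIntegers_iff (x : (Valuation.valuationSubring (Valuation.comap (algebraMap (maxUnramified (v.adicCompletion K)) (AlgebraicClosure (v.adicCompletion K))) w))) : IsUnit x ↔ w ((x : (maxUnramified (v.adicCompletion K))) : (AlgebraicClosure (v.adicCompletion K))) = 1 :=
  (Valuation.valuationSubring.integers ((Valuation.comap (algebraMap (maxUnramified (v.adicCompletion K)) (AlgebraicClosure (v.adicCompletion K))) w))).isUnit_iff_valuation_eq_one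

/-- The maximal ideal of `𝒪ⁿʳ` is cut out by `w < 1`. [folklore] -/
theorem mem_maximalIdeal_unrIntegers_iff (x : (Valuation.valuationSubring (Valuation.comap (algebraMap (maxUnramified (v.adicCompletion K)) (AlgebraicClosure (v.adicCompletion K))) w))) :
    x ∈ IsLocalRing.maximalIdeal (Valuation.valuationSubring (Valuation.comap (algebraMap (maxUnramified (v.adicCompletion K)) (AlgebraicClosure (v.adicCompletion K))) w)) ↔ w ((x : (maxUnramified (v.adicCompletion K))) : (AlgebraicClosure (v.adicCompletion K))) < 1 := by
  rw [IsLocalRing.mem_maximalIdeal, mem_nonunits_iff, isUnit_unrIntegers_iff]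
  exact ⟨fun h ↦ lt_of_le_of_ne x.2 h, fun h ↦ h.ne⟩

include hw

/-- **The value group of `𝒪ⁿʳ`**: a non-zero element of `𝒪ⁿʳ` has `w`-value `|ϖ|ᵐ` for some
`m ≥ 0` (`ϖ` a uniformiser of `𝓞_v`; Neukirch, *ANT*, II (7.5) with (9.11): `K_v^nr/K_v` is
unramified; tree `exists_spectralValuation_eq_pow_of_forall_inertia`).
[cite: NeukirchANT1999, Ch. II Prop. (7.5) with Prop. (9.11)] -/
theorem exists_spectralValuation_unrIntegers_eq_pow {ϖ : v.adicCompletionIntegers K}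
    (hϖ : Irreducible ϖ) {x : (Valuation.valuationSubring (Valuation.comap (algebraMap (maxUnramified (v.adicCompletion K)) (AlgebraicClosure (v.adicCompletion K))) w))} (hx : x ≠ 0) :
    ∃ m : ℕ, w ((x : (maxUnramified (v.adicCompletion K))) : (AlgebraicClosure (v.adicCompletion K))) = w (algebraMap (v.adicCompletion K) (AlgebraicClosure (v.adicCompletion K)) (ϖ : (v.adicCompletion K))) ^ m := by
  obtain ⟨𝔐, h𝔐⟩ := v.localPrimesAbove_nonempty
  rcases (coe_unrIntegers_le_one x).eq_or_lt with h1 | hlt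
  · exact ⟨0, by rw [pow_zero]; exact h1⟩
  · obtain ⟨m, -, hm⟩ := exists_spectralValuation_eq_pow_of_forall_inertia hw h𝔐 hϖ
      (fun σ hσ ↦ smul_coe_maxUnramified hw h𝔐 _ hσ)
      ((Valuation.pos_iff _).mpr (coe_coe_unrIntegers_ne_zero hx)) hlt
    exact ⟨m, hm⟩

/-- An element of `𝒪ⁿʳ` of `w`-value `< 1` has `w`-value `≤ |ϖ|`. [folklore] -/
theorem spectralValuation_unrIntegers_le_of_lt_one {ϖ : v.adicCompletionIntegers K}
    (hϖ : Irreducible ϖ) {x : (Valuation.valuationSubring (Valuation.comap (algebraMap (maxUnramified (v.adicCompletion K)) (AlgebraicClosure (v.adicCompletion K))) w))} (hx : w ((x : (maxUnramified (v.adicCompletion K))) : (AlgebraicClosure (v.adicCompletion K))) < 1) :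
    w ((x : (maxUnramified (v.adicCompletion K))) : (AlgebraicClosure (v.adicCompletion K))) ≤ w (algebraMap (v.adicCompletion K) (AlgebraicClosure (v.adicCompletion K)) (ϖ : (v.adicCompletion K))) := by
  obtain ⟨𝔐, h𝔐⟩ := v.localPrimesAbove_nonempty
  exact spectralValuation_le_of_forall_inertia hw h𝔐 hϖ
    (fun σ hσ ↦ smul_coe_maxUnramified hw h𝔐 _ hσ) hx

/-- **A uniformiser of `𝓞_v` is irreducible in `𝒪ⁿʳ`** (`K_v^nr/K_v` is unramified: an element
of `𝒪ⁿʳ` of value `< 1` has value `≤ |ϖ|`). [cite: NeukirchANT1999, Ch. II Prop. (7.5) with Prop. (9.11)] -/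
theorem irreducible_unrIntegers_of_coe_eq {ϖ : v.adicCompletionIntegers K} (hϖ : Irreducible ϖ)
    {ϖ' : (Valuation.valuationSubring (Valuation.comap (algebraMap (maxUnramified (v.adicCompletion K)) (AlgebraicClosure (v.adicCompletion K))) w))} (hϖ' : ((ϖ' : (maxUnramified (v.adicCompletion K))) : (AlgebraicClosure (v.adicCompletion K))) = algebraMap (v.adicCompletion K) (AlgebraicClosure (v.adicCompletion K)) (ϖ : (v.adicCompletion K))) : Irreducible ϖ' := by
  obtain ⟨hpos, hlt1⟩ := spectralValuation_uniformizer_pos_lt_one hw hϖ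
  refine irreducible_iff.mpr ⟨?_, fun a b hab ↦ ?_⟩
  · rw [isUnit_unrIntegers_iff, hϖ']
    exact hlt1.ne
  · by_cases ha : IsUnit a
    · exact Or.inl ha
    · right
      rw [isUnit_unrIntegers_iff] at ha ⊢
      have ha' : w ((a : (maxUnramified (v.adicCompletion K))) : (AlgebraicClosure (v.adicCompletion K))) < 1 := lt_of_le_of_ne a.2 ha
      have hale := spectralValuation_unrIntegers_le_of_lt_one hw hϖ ha'
      have hprod : w ((a : (maxUnramified (v.adicCompletion K))) : (AlgebraicClosure (v.adicCompletion K))) * w ((b : (maxUnramified (v.adicCompletion K))) : (AlgebraicClosure (v.adicCompletion K))) = w (algebraMap (v.adicCompletion K) (AlgebraicClosure (v.adicCompletion K)) (ϖ : (v.adicCompletion K))) := by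
        rw [← map_mul, ← hϖ', hab]
        rfl
      refine le_antisymm b.2 ?_
      by_contra hb
      rw [not_le] at hb
      have : w ((a : (maxUnramified (v.adicCompletion K))) : (AlgebraicClosure (v.adicCompletion K))) * w ((b : (maxUnramified (v.adicCompletion K))) : (AlgebraicClosure (v.adicCompletion K))) < w (algebraMap (v.adicCompletion K) (AlgebraicClosure (v.adicCompletion K)) (ϖ : (v.adicCompletion K))) * 1 :=
        mul_lt_mul_of_le_of_lt_of_nonneg_of_pos hale hb zero_le hpos
      rw [mul_one, hprod] at this
      exact lt_irrefl _ this

/-- **Every non-zero element of `𝒪ⁿʳ` is a unit times a power of the uniformiser.** [folklore] -/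
theorem exists_eq_pow_mul_unit_unrIntegers {ϖ : v.adicCompletionIntegers K} (hϖ : Irreducible ϖ)
    {ϖ' : (Valuation.valuationSubring (Valuation.comap (algebraMap (maxUnramified (v.adicCompletion K)) (AlgebraicClosure (v.adicCompletion K))) w))} (hϖ' : ((ϖ' : (maxUnramified (v.adicCompletion K))) : (AlgebraicClosure (v.adicCompletion K))) = algebraMap (v.adicCompletion K) (AlgebraicClosure (v.adicCompletion K)) (ϖ : (v.adicCompletion K))) {x : (Valuation.valuationSubring (Valuation.comap (algebraMap (maxUnramified (v.adicCompletion K)) (AlgebraicClosure (v.adicCompletion K))) w))} (hx : x ≠ 0) :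
    ∃ (n : ℕ) (u : (Valuation.valuationSubring (Valuation.comap (algebraMap (maxUnramified (v.adicCompletion K)) (AlgebraicClosure (v.adicCompletion K))) w))), IsUnit u ∧ x = ϖ' ^ n * u := by
  obtain ⟨n, hn⟩ := exists_spectralValuation_unrIntegers_eq_pow hw hϖ hx
  obtain ⟨hpos, -⟩ := spectralValuation_uniformizer_pos_lt_one hw hϖ
  have hϖ0 : (ϖ' : (maxUnramified (v.adicCompletion K))) ≠ 0 := by
    intro h
    have : ((ϖ' : (maxUnramified (v.adicCompletion K))) : (AlgebraicClosure (v.adicCompletion K))) = 0 := by rw [h]; rfl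
    rw [hϖ'] at this
    rw [this, Valuation.map_zero] at hpos
    exact lt_irrefl _ hpos
  set c : (maxUnramified (v.adicCompletion K)) := (x : (maxUnramified (v.adicCompletion K))) / (ϖ' : (maxUnramified (v.adicCompletion K))) ^ n with hc
  have hwc : w (c : (AlgebraicClosure (v.adicCompletion K))) = 1 := by
    have e : ((c : (maxUnramified (v.adicCompletion K))) : (AlgebraicClosure (v.adicCompletion K))) = ((x : (maxUnramified (v.adicCompletion K))) : (AlgebraicClosure (v.adicCompletion K))) / ((ϖ' : (maxUnramified (v.adicCompletion K))) : (AlgebraicClosure (v.adicCompletion K))) ^ n := by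
      rw [hc]; push_cast; rfl
    rw [e, map_div₀, map_pow, hϖ', hn, div_self]
    exact pow_ne_zero _ hpos.ne'
  have hcmem : c ∈ ((Valuation.valuationSubring (Valuation.comap (algebraMap (maxUnramified (v.adicCompletion K)) (AlgebraicClosure (v.adicCompletion K))) w))) := by
    change ((Valuation.comap (algebraMap (maxUnramified (v.adicCompletion K)) (AlgebraicClosure (v.adicCompletion K))) w)) c ≤ 1
    rw [comap_maxUnramified_apply, hwc]
  refine ⟨n, ⟨c, hcmem⟩, (isUnit_unrIntegers_iff _).mpr hwc, Subtype.ext ?_⟩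
  change (x : (maxUnramified (v.adicCompletion K))) = (ϖ' : (maxUnramified (v.adicCompletion K))) ^ n * c
  rw [hc, mul_div_cancel₀ _ (pow_ne_zero _ hϖ0)]

/-- **`𝒪ⁿʳ`, the valuation ring of `K_v^nr = (K̄_v)^{I_𝔐}`, is a discrete valuation ring** with
the uniformiser of `𝓞_v` as uniformiser (Neukirch, *ANT*, II (7.5), (9.11): the maximal unramified
extension has the value group of `K_v`). [cite: NeukirchANT1999, Ch. II Prop. (7.5) with Prop. (9.11)] -/
theorem isDiscreteValuationRing_unrIntegers : IsDiscreteValuationRing (Valuation.valuationSubring (Valuation.comap (algebraMap (maxUnramified (v.adicCompletion K)) (AlgebraicClosure (v.adicCompletion K))) w)) := by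
  obtain ⟨ϖ, hϖ⟩ := IsDiscreteValuationRing.exists_irreducible (v.adicCompletionIntegers K)
  have hle : w ((algebraMap (v.adicCompletion K) (maxUnramified (v.adicCompletion K)) (ϖ : (v.adicCompletion K)) : (maxUnramified (v.adicCompletion K))) : (AlgebraicClosure (v.adicCompletion K))) ≤ 1 := by
    rw [IntermediateField.coe_algebraMap_apply]
    exact (spectralValuation_uniformizer_pos_lt_one hw hϖ).2.le
  set ϖ' : (Valuation.valuationSubring (Valuation.comap (algebraMap (maxUnramified (v.adicCompletion K)) (AlgebraicClosure (v.adicCompletion K))) w)) := ⟨algebraMap (v.adicCompletion K) (maxUnramified (v.adicCompletion K)) (ϖ : (v.adicCompletion K)), hle⟩ with hϖ'def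
  have hϖ' : ((ϖ' : (maxUnramified (v.adicCompletion K))) : (AlgebraicClosure (v.adicCompletion K))) = algebraMap (v.adicCompletion K) (AlgebraicClosure (v.adicCompletion K)) (ϖ : (v.adicCompletion K)) :=
    IntermediateField.coe_algebraMap_apply (S := (maxUnramified (v.adicCompletion K))) (ϖ : (v.adicCompletion K))
  refine IsDiscreteValuationRing.ofHasUnitMulPowIrreducibleFactorization
    ⟨ϖ', irreducible_unrIntegers_of_coe_eq hw hϖ hϖ', fun {x} hx ↦ ?_⟩
  obtain ⟨n, u, hu, hx'⟩ := exists_eq_pow_mul_unit_unrIntegers hw hϖ hϖ' hx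
  exact ⟨n, hu.unit, by rw [hu.unit_spec, hx']⟩

/-- **Powers of the maximal ideal of `𝒪ⁿʳ` are cut out by `w ≤ |ϖ|ᵏ`.** [folklore] -/
theorem mem_maximalIdeal_unrIntegers_pow_iff {ϖ : v.adicCompletionIntegers K} (hϖ : Irreducible ϖ)
    (x : (Valuation.valuationSubring (Valuation.comap (algebraMap (maxUnramified (v.adicCompletion K)) (AlgebraicClosure (v.adicCompletion K))) w))) (k : ℕ) :
    x ∈ IsLocalRing.maximalIdeal (Valuation.valuationSubring (Valuation.comap (algebraMap (maxUnramified (v.adicCompletion K)) (AlgebraicClosure (v.adicCompletion K))) w)) ^ k ↔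
      w ((x : (maxUnramified (v.adicCompletion K))) : (AlgebraicClosure (v.adicCompletion K))) ≤ w (algebraMap (v.adicCompletion K) (AlgebraicClosure (v.adicCompletion K)) (ϖ : (v.adicCompletion K))) ^ k := by
  haveI := isDiscreteValuationRing_unrIntegers hw
  obtain ⟨hpos, hlt1⟩ := spectralValuation_uniformizer_pos_lt_one hw hϖ
  have hle : w ((algebraMap (v.adicCompletion K) (maxUnramified (v.adicCompletion K)) (ϖ : (v.adicCompletion K)) : (maxUnramified (v.adicCompletion K))) : (AlgebraicClosure (v.adicCompletion K))) ≤ 1 := by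
    rw [IntermediateField.coe_algebraMap_apply]; exact hlt1.le
  set ϖ' : (Valuation.valuationSubring (Valuation.comap (algebraMap (maxUnramified (v.adicCompletion K)) (AlgebraicClosure (v.adicCompletion K))) w)) := ⟨algebraMap (v.adicCompletion K) (maxUnramified (v.adicCompletion K)) (ϖ : (v.adicCompletion K)), hle⟩ with hϖ'def
  have hϖ' : ((ϖ' : (maxUnramified (v.adicCompletion K))) : (AlgebraicClosure (v.adicCompletion K))) = algebraMap (v.adicCompletion K) (AlgebraicClosure (v.adicCompletion K)) (ϖ : (v.adicCompletion K)) :=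
    IntermediateField.coe_algebraMap_apply (S := (maxUnramified (v.adicCompletion K))) (ϖ : (v.adicCompletion K))
  have hϖ0 : (ϖ' : (maxUnramified (v.adicCompletion K))) ≠ 0 := by
    intro h
    have : ((ϖ' : (maxUnramified (v.adicCompletion K))) : (AlgebraicClosure (v.adicCompletion K))) = 0 := by rw [h]; rfl
    rw [hϖ'] at this
    rw [this, Valuation.map_zero] at hpos
    exact lt_irrefl _ hpos
  rw [mem_maximalIdeal_pow_iff_dvd_of_irreducible (irreducible_unrIntegers_of_coe_eq hw hϖ hϖ') x k]
  constructor
  · rintro ⟨c, rfl⟩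
    have e : (((ϖ' ^ k * c : (Valuation.valuationSubring (Valuation.comap (algebraMap (maxUnramified (v.adicCompletion K)) (AlgebraicClosure (v.adicCompletion K))) w))) : (maxUnramified (v.adicCompletion K))) : (AlgebraicClosure (v.adicCompletion K))) = ((ϖ' : (maxUnramified (v.adicCompletion K))) : (AlgebraicClosure (v.adicCompletion K))) ^ k * ((c : (maxUnramified (v.adicCompletion K))) : (AlgebraicClosure (v.adicCompletion K))) := by
      push_cast; rfl
    rw [e, map_mul, map_pow, hϖ']
    exact mul_le_of_le_one_right' c.2
  · intro h
    set c : (maxUnramified (v.adicCompletion K)) := (x : (maxUnramified (v.adicCompletion K))) / (ϖ' : (maxUnramified (v.adicCompletion K))) ^ k with hc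
    have hcmem : c ∈ ((Valuation.valuationSubring (Valuation.comap (algebraMap (maxUnramified (v.adicCompletion K)) (AlgebraicClosure (v.adicCompletion K))) w))) := by
      change ((Valuation.comap (algebraMap (maxUnramified (v.adicCompletion K)) (AlgebraicClosure (v.adicCompletion K))) w)) c ≤ 1
      rw [comap_maxUnramified_apply]
      have e : ((c : (maxUnramified (v.adicCompletion K))) : (AlgebraicClosure (v.adicCompletion K))) = ((x : (maxUnramified (v.adicCompletion K))) : (AlgebraicClosure (v.adicCompletion K))) / ((ϖ' : (maxUnramified (v.adicCompletion K))) : (AlgebraicClosure (v.adicCompletion K))) ^ k := by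
        rw [hc]; push_cast; rfl
      rw [e, map_div₀, map_pow, hϖ']
      exact div_le_one_of_le₀ h zero_le
    refine ⟨⟨c, hcmem⟩, Subtype.ext ?_⟩
    change (x : (maxUnramified (v.adicCompletion K))) = (ϖ' : (maxUnramified (v.adicCompletion K))) ^ k * c
    rw [hc, mul_div_cancel₀ _ (pow_ne_zero _ hϖ0)]

/-- **Powers of the maximal ideal of `𝓞_v` are cut out by `w ≤ |ϖ|ᵏ`** (for the spectral
valuation of `K̄_v` restricted to `K_v`). [folklore] -/
theorem mem_maximalIdeal_adicCompletionIntegers_pow_iff {ϖ : v.adicCompletionIntegers K}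
    (hϖ : Irreducible ϖ) (a : v.adicCompletionIntegers K) (k : ℕ) :
    a ∈ IsLocalRing.maximalIdeal (v.adicCompletionIntegers K) ^ k ↔
      w (algebraMap (v.adicCompletion K) (AlgebraicClosure (v.adicCompletion K)) (a : (v.adicCompletion K))) ≤ w (algebraMap (v.adicCompletion K) (AlgebraicClosure (v.adicCompletion K)) (ϖ : (v.adicCompletion K))) ^ k := by
  obtain ⟨hpos, hlt1⟩ := spectralValuation_uniformizer_pos_lt_one hw hϖ
  have hϖ0 : (ϖ : (v.adicCompletion K)) ≠ 0 := by exact_mod_cast hϖ.ne_zero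
  rw [mem_maximalIdeal_pow_iff_dvd_of_irreducible hϖ a k]
  constructor
  · rintro ⟨c, rfl⟩
    push_cast
    rw [map_mul, map_pow]
    exact mul_le_of_le_one_right' ((spectralValuation_algebraMap_le_one_iff hw _).mpr c.2)
  · intro h
    set c : (v.adicCompletion K) := (a : (v.adicCompletion K)) / (ϖ : (v.adicCompletion K)) ^ k with hc
    have hcmem : c ∈ v.adicCompletionIntegers K := by
      rw [← spectralValuation_algebraMap_le_one_iff hw, hc, map_div₀, map_pow, map_div₀, map_pow]
      exact div_le_one_of_le₀ h zero_le
    refine ⟨⟨c, hcmem⟩, Subtype.ext ?_⟩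
    push_cast
    rw [hc, mul_div_cancel₀ _ (pow_ne_zero _ hϖ0)]

omit hw

/-- **Uniqueness in Hensel's lemma** over the valuation ring of a valued field: two roots of a
polynomial `f ∈ 𝒪_w[X]` congruent modulo `𝔪_w` to an approximate root `a₀` at which `f'` is a
unit coincide (`f(b) = f(a) + f'(a)(b - a) + k(b - a)²`, Mathlib `Polynomial.binomExpansion`, and
`f'(a) + k(b - a)` is a unit).  Neukirch, *ANT*, II (4.6). [folklore] -/
theorem _root_.Literature.NumberTheory.EllipticCurves.eq_of_isRoot_of_sub_mem_maximalIdeal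
    {L : Type*} [Field L] {w : Valuation L ℝ≥0} (f : (w.integer)[X]) {a b a₀ : w.integer}
    (ha : f.IsRoot a) (hb : f.IsRoot b) (ha₀ : a - a₀ ∈ IsLocalRing.maximalIdeal w.integer)
    (hb₀ : b - a₀ ∈ IsLocalRing.maximalIdeal w.integer)
    (hder : IsUnit (f.derivative.eval a₀)) : a = b := by
  obtain ⟨k, hk⟩ := f.binomExpansion a (b - a)
  rw [add_sub_cancel, show f.eval b = 0 from hb, show f.eval a = 0 from ha, zero_add] at hk
  -- `f'(a)` is a unit: `f'(a) ≡ f'(a₀)`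
  have hres : IsLocalRing.residue w.integer a = IsLocalRing.residue w.integer a₀ := by
    rw [← sub_eq_zero, ← map_sub, IsLocalRing.residue_eq_zero_iff]; exact ha₀
  have hder' : IsUnit (f.derivative.eval a + k * (b - a)) := by
    apply isUnit_of_residue_ne_zero
    have hba : IsLocalRing.residue w.integer (b - a) = 0 := by
      rw [(IsLocalRing.residue_eq_zero_iff _)]
      have : b - a = (b - a₀) - (a - a₀) := by ring
      rw [this]
      exact Ideal.sub_mem _ hb₀ ha₀
    rw [map_add, map_mul, hba, mul_zero, add_zero, ← Polynomial.eval_map_apply, hres,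
      Polynomial.eval_map_apply]
    exact (IsLocalRing.residue_ne_zero_iff_isUnit _).mpr hder
  have h0 : (b - a) * (f.derivative.eval a + k * (b - a)) = 0 := by
    rw [mul_add, ← mul_assoc, mul_comm (b - a) k, mul_assoc, ← sq, mul_comm (b - a)]; exact hk.symm
  have := (mul_eq_zero.mp h0).resolve_right hder'.ne_zero
  exact (sub_eq_zero.mp this).symm

include hw

omit hw in
/-- The embedding `𝒪ⁿʳ → 𝒪_w` into the valuation ring of `K̄_v` (identity on elements).
[folklore] -/
theorem exists_ringHom_unrIntegers_integer :
    ∃ ψ : (Valuation.valuationSubring (Valuation.comap (algebraMap (maxUnramified (v.adicCompletion K)) (AlgebraicClosure (v.adicCompletion K))) w)) →+* w.integer, ∀ x : (Valuation.valuationSubring (Valuation.comap (algebraMap (maxUnramified (v.adicCompletion K)) (AlgebraicClosure (v.adicCompletion K))) w)), ((ψ x : w.integer) : (AlgebraicClosure (v.adicCompletion K))) = ((x : (maxUnramified (v.adicCompletion K))) : (AlgebraicClosure (v.adicCompletion K))) :=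
  ⟨((algebraMap (maxUnramified (v.adicCompletion K)) (AlgebraicClosure (v.adicCompletion K))).comp (algebraMap (Valuation.valuationSubring (Valuation.comap (algebraMap (maxUnramified (v.adicCompletion K)) (AlgebraicClosure (v.adicCompletion K))) w)) (maxUnramified (v.adicCompletion K)))).codRestrict w.integer
    (fun x ↦ coe_unrIntegers_le_one x), fun _ ↦ rfl⟩

/-- **A root in `𝒪_w` of a polynomial with coefficients in `K_v^nr` which is simple modulo `𝔐`
lies in `K_v^nr`**: its conjugates under the inertia group `I_𝔐` are roots congruent to it modulo
`𝔐`, hence equal to it (`eq_of_isRoot_of_sub_mem_maximalIdeal`), and `K_v^nr` is the fixed field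
of `I_𝔐` (`mem_maxUnramified_iff_forall_inertia`).  (The coefficient ring `S` is any ring mapping
to `𝒪_w` with image in `K_v^nr`, e.g. `𝒪ⁿʳ`.)
[cite: NeukirchANT1999, Ch. II (6.6)–(6.8) with Prop. (9.11)] -/
theorem mem_maxUnramified_of_isRoot_map {S : Type*} [CommRing S] {ψ : S →+* w.integer}
    (hψ : ∀ x : S, ((ψ x : w.integer) : (AlgebraicClosure (v.adicCompletion K))) ∈ maxUnramified (v.adicCompletion K)) (f : S[X])
    {b : w.integer} (hb : (f.map ψ).IsRoot b)
    (hder : IsUnit ((f.map ψ).derivative.eval b)) : (b : (AlgebraicClosure (v.adicCompletion K))) ∈ maxUnramified (v.adicCompletion K) := by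
  obtain ⟨𝔐, h𝔐⟩ := v.localPrimesAbove_nonempty
  have hvw : w.Integers w.integer := Valuation.integer.integers w
  refine (mem_maxUnramified_iff_forall_inertia hw h𝔐).mpr fun σ hσ ↦ ?_
  have hσ₁ : ∀ z, w (absoluteGaloisGroup.toAlgEquiv (v.adicCompletion K) σ z) = w z := fun z ↦ spectralValuation_smul hw σ z
  have hσ₂ := (mem_inertia_iff_spectralValuation hw h𝔐).mp hσ
  have hb'1 : w (absoluteGaloisGroup.toAlgEquiv (v.adicCompletion K) σ (b : (AlgebraicClosure (v.adicCompletion K)))) ≤ 1 := by rw [hσ₁]; exact b.2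
  -- `σ b` is a root of `f`
  have hGfix : ((f.map ψ).map (algebraMap w.integer (AlgebraicClosure (v.adicCompletion K)))).map
      ((absoluteGaloisGroup.toAlgEquiv (v.adicCompletion K) σ : (AlgebraicClosure (v.adicCompletion K)) ≃ₐ[(v.adicCompletion K)] (AlgebraicClosure (v.adicCompletion K))) : (AlgebraicClosure (v.adicCompletion K)) →+* (AlgebraicClosure (v.adicCompletion K))) =
        (f.map ψ).map (algebraMap w.integer (AlgebraicClosure (v.adicCompletion K))) := by
    refine Polynomial.ext fun n ↦ ?_
    simp only [Polynomial.coeff_map, RingHom.coe_coe]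
    exact (mem_maxUnramified_iff_forall_inertia hw h𝔐).mp (hψ _) σ hσ
  have hGb : ((f.map ψ).map (algebraMap w.integer (AlgebraicClosure (v.adicCompletion K)))).eval (b : (AlgebraicClosure (v.adicCompletion K))) = 0 := by
    change ((f.map ψ).map (algebraMap w.integer (AlgebraicClosure (v.adicCompletion K)))).eval (algebraMap w.integer (AlgebraicClosure (v.adicCompletion K)) b) = 0
    rw [Polynomial.eval_map_apply, show (f.map ψ).eval b = 0 from hb, map_zero]
  have hGb' : ((f.map ψ).map (algebraMap w.integer (AlgebraicClosure (v.adicCompletion K)))).eval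
      (absoluteGaloisGroup.toAlgEquiv (v.adicCompletion K) σ (b : (AlgebraicClosure (v.adicCompletion K)))) = 0 := by
    have e2 := Polynomial.eval_map_apply
      ((absoluteGaloisGroup.toAlgEquiv (v.adicCompletion K) σ : (AlgebraicClosure (v.adicCompletion K)) ≃ₐ[(v.adicCompletion K)] (AlgebraicClosure (v.adicCompletion K))) : (AlgebraicClosure (v.adicCompletion K)) →+* (AlgebraicClosure (v.adicCompletion K))) (b : (AlgebraicClosure (v.adicCompletion K)))
      (p := (f.map ψ).map (algebraMap w.integer (AlgebraicClosure (v.adicCompletion K))))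
    rw [hGfix, RingHom.coe_coe, hGb, map_zero] at e2
    exact e2
  have hb'root : (f.map ψ).IsRoot ⟨_, hb'1⟩ := by
    rw [Polynomial.IsRoot.def]
    apply hvw.hom_inj
    rw [map_zero, ← Polynomial.eval_map_apply]
    exact hGb'
  -- `σ b ≡ b (mod 𝔐)`, so `σ b = b`
  have hb'b : (⟨_, hb'1⟩ : w.integer) - b ∈ IsLocalRing.maximalIdeal w.integer := by
    rw [← IsLocalRing.residue_eq_zero_iff, ← v_algebraMap_lt_one_iff hvw]
    exact hσ₂ _ b.2
  have hderb : IsUnit ((f.map ψ).derivative.eval b) := hder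
  have key := eq_of_isRoot_of_sub_mem_maximalIdeal (f.map ψ) hb'root hb hb'b
    (by rw [sub_self]; exact Ideal.zero_mem _) hderb
  exact congrArg (fun z : w.integer ↦ (z : (AlgebraicClosure (v.adicCompletion K)))) key

/-- **`𝒪ⁿʳ` is henselian.**  A simple root modulo `𝔪` of a monic `f ∈ 𝒪ⁿʳ[X]` lifts to a root
in the valuation ring of `K̄_v` (which is henselian, `henselianLocalRing_integer`), and that root
lies in `K_v^nr` (`mem_maxUnramified_of_isRoot_map`).  Neukirch, *ANT*, II §6 and (9.11).
[cite: NeukirchANT1999, Ch. II (6.6)–(6.8) with Prop. (9.11)] -/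
theorem henselianLocalRing_unrIntegers : HenselianLocalRing (Valuation.valuationSubring (Valuation.comap (algebraMap (maxUnramified (v.adicCompletion K)) (AlgebraicClosure (v.adicCompletion K))) w)) := by
  obtain ⟨ψ, hψ⟩ := exists_ringHom_unrIntegers_integer (w := w)
  haveI := henselianLocalRing_integer w
  have hvw : w.Integers w.integer := Valuation.integer.integers w
  have hψinj : Function.Injective ψ := fun x y hxy ↦ by
    have h1 : ((x : (maxUnramified (v.adicCompletion K))) : (AlgebraicClosure (v.adicCompletion K))) = ((y : (maxUnramified (v.adicCompletion K))) : (AlgebraicClosure (v.adicCompletion K))) := by rw [← hψ, ← hψ, hxy]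
    exact Subtype.ext (Subtype.ext h1)
  have hψmax : ∀ x : (Valuation.valuationSubring (Valuation.comap (algebraMap (maxUnramified (v.adicCompletion K)) (AlgebraicClosure (v.adicCompletion K))) w)), ψ x ∈ IsLocalRing.maximalIdeal w.integer ↔
      x ∈ IsLocalRing.maximalIdeal (Valuation.valuationSubring (Valuation.comap (algebraMap (maxUnramified (v.adicCompletion K)) (AlgebraicClosure (v.adicCompletion K))) w)) := fun x ↦ by
    rw [mem_maximalIdeal_unrIntegers_iff, ← IsLocalRing.residue_eq_zero_iff,
      ← v_algebraMap_lt_one_iff hvw, ← hψ x]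
    rfl
  refine HenselianLocalRing.mk (is_henselian := fun f hf a₀ h₀ hder ↦ ?_)
  have hF₀ : (f.map ψ).eval (ψ a₀) ∈ IsLocalRing.maximalIdeal w.integer := by
    rw [Polynomial.eval_map_apply, hψmax]; exact h₀
  have hFder : IsUnit ((f.map ψ).derivative.eval (ψ a₀)) := by
    rw [Polynomial.derivative_map, Polynomial.eval_map_apply]; exact hder.map ψ
  obtain ⟨b, hbroot, hb₀⟩ := HenselianLocalRing.is_henselian (f.map ψ) (hf.map ψ) (ψ a₀) hF₀ hFder
  -- `f'(b)` is a unit too (`b ≡ a₀`)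
  have hFderb : IsUnit ((f.map ψ).derivative.eval b) := by
    have hres : IsLocalRing.residue w.integer b = IsLocalRing.residue w.integer (ψ a₀) := by
      rw [← sub_eq_zero, ← map_sub, IsLocalRing.residue_eq_zero_iff]; exact hb₀
    rw [← IsLocalRing.residue_ne_zero_iff_isUnit, ← Polynomial.eval_map_apply, hres,
      Polynomial.eval_map_apply, IsLocalRing.residue_ne_zero_iff_isUnit]
    exact hFder
  have hψmem : ∀ x : (Valuation.valuationSubring (Valuation.comap (algebraMap (maxUnramified (v.adicCompletion K)) (AlgebraicClosure (v.adicCompletion K))) w)), ((ψ x : w.integer) : (AlgebraicClosure (v.adicCompletion K))) ∈ maxUnramified (v.adicCompletion K) := fun x ↦ by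
    rw [hψ]; exact (x : (maxUnramified (v.adicCompletion K))).2
  have hbmem : (b : (AlgebraicClosure (v.adicCompletion K))) ∈ maxUnramified (v.adicCompletion K) := mem_maxUnramified_of_isRoot_map hw hψmem f hbroot hFderb
  have hble : (⟨(b : (AlgebraicClosure (v.adicCompletion K))), hbmem⟩ : (maxUnramified (v.adicCompletion K))) ∈ ((Valuation.valuationSubring (Valuation.comap (algebraMap (maxUnramified (v.adicCompletion K)) (AlgebraicClosure (v.adicCompletion K))) w))) := by
    rw [Valuation.mem_valuationSubring_iff, comap_maxUnramified_apply]
    exact b.2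
  have hψa : ψ ⟨⟨(b : (AlgebraicClosure (v.adicCompletion K))), hbmem⟩, hble⟩ = b := by
    apply Subtype.ext
    rw [hψ]
  refine ⟨⟨⟨(b : (AlgebraicClosure (v.adicCompletion K))), hbmem⟩, hble⟩, ?_, ?_⟩
  · rw [Polynomial.IsRoot.def]
    apply hψinj
    rw [map_zero, ← Polynomial.eval_map_apply, hψa]
    exact hbroot
  · rw [← hψmax, map_sub, hψa]
    exact hb₀


/-! ## The structure map `𝓞_v → 𝒪ⁿʳ` and the transfer of `𝔪`-adic conditions -/

/-- **The structure map `𝓞_v → 𝒪ⁿʳ`** (through `K_v → K_v^nr ⊆ K̄_v`; it exists since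
`|a|_v ≤ 1` for `a ∈ 𝓞_v`). [folklore] -/
theorem exists_ringHom_adicCompletionIntegers_unrIntegers :
    ∃ φ : v.adicCompletionIntegers K →+* (Valuation.valuationSubring (Valuation.comap (algebraMap (maxUnramified (v.adicCompletion K)) (AlgebraicClosure (v.adicCompletion K))) w)),
      ∀ a, (((φ a : (Valuation.valuationSubring (Valuation.comap (algebraMap (maxUnramified (v.adicCompletion K)) (AlgebraicClosure (v.adicCompletion K))) w))) : (maxUnramified (v.adicCompletion K))) : (AlgebraicClosure (v.adicCompletion K))) = algebraMap (v.adicCompletion K) (AlgebraicClosure (v.adicCompletion K)) (a : (v.adicCompletion K)) := by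
  have hmem : ∀ a : v.adicCompletionIntegers K, algebraMap (v.adicCompletion K) (maxUnramified (v.adicCompletion K)) (a : (v.adicCompletion K)) ∈ ((Valuation.valuationSubring (Valuation.comap (algebraMap (maxUnramified (v.adicCompletion K)) (AlgebraicClosure (v.adicCompletion K))) w))) := fun a ↦ by
    rw [Valuation.mem_valuationSubring_iff, comap_maxUnramified_apply,
      IntermediateField.coe_algebraMap_apply]
    exact (spectralValuation_algebraMap_le_one_iff hw (a : (v.adicCompletion K))).mpr a.2
  refine ⟨((algebraMap (v.adicCompletion K) (maxUnramified (v.adicCompletion K))).comp (algebraMap (v.adicCompletionIntegers K) (v.adicCompletion K))).codRestrict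
    ((Valuation.valuationSubring (Valuation.comap (algebraMap (maxUnramified (v.adicCompletion K)) (AlgebraicClosure (v.adicCompletion K))) w))) (fun a ↦ hmem a), fun a ↦ ?_⟩
  exact IntermediateField.coe_algebraMap_apply (S := (maxUnramified (v.adicCompletion K))) (a : (v.adicCompletion K))

omit hw in
/-- The structure map `𝓞_v → 𝒪ⁿʳ` is injective. [folklore] -/
theorem injective_of_coe_eq_algebraMap {φ : v.adicCompletionIntegers K →+* (Valuation.valuationSubring (Valuation.comap (algebraMap (maxUnramified (v.adicCompletion K)) (AlgebraicClosure (v.adicCompletion K))) w))}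
    (hφ : ∀ a, (((φ a : (Valuation.valuationSubring (Valuation.comap (algebraMap (maxUnramified (v.adicCompletion K)) (AlgebraicClosure (v.adicCompletion K))) w))) : (maxUnramified (v.adicCompletion K))) : (AlgebraicClosure (v.adicCompletion K))) = algebraMap (v.adicCompletion K) (AlgebraicClosure (v.adicCompletion K)) (a : (v.adicCompletion K))) :
    Function.Injective φ := fun a b hab ↦ by
  have h := congrArg (fun z : (Valuation.valuationSubring (Valuation.comap (algebraMap (maxUnramified (v.adicCompletion K)) (AlgebraicClosure (v.adicCompletion K))) w)) ↦ ((z : (maxUnramified (v.adicCompletion K))) : (AlgebraicClosure (v.adicCompletion K)))) hab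
  simp only [hφ] at h
  exact_mod_cast (algebraMap (v.adicCompletion K) (AlgebraicClosure (v.adicCompletion K))).injective h

/-- **Transfer of `𝔪`-adic divisibility along `𝓞_v → 𝒪ⁿʳ`** (the extension is unramified:
`a ∈ 𝓂_vᵏ ↔ φ a ∈ 𝔪ⁿʳᵏ`, both being `|a|_v ≤ |ϖ|ᵏ`). [cite: NeukirchANT1999, Ch. II Prop. (7.5) with Prop. (9.11)] -/
theorem map_mem_maximalIdeal_pow_iff {φ : v.adicCompletionIntegers K →+* (Valuation.valuationSubring (Valuation.comap (algebraMap (maxUnramified (v.adicCompletion K)) (AlgebraicClosure (v.adicCompletion K))) w))}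
    (hφ : ∀ a, (((φ a : (Valuation.valuationSubring (Valuation.comap (algebraMap (maxUnramified (v.adicCompletion K)) (AlgebraicClosure (v.adicCompletion K))) w))) : (maxUnramified (v.adicCompletion K))) : (AlgebraicClosure (v.adicCompletion K))) = algebraMap (v.adicCompletion K) (AlgebraicClosure (v.adicCompletion K)) (a : (v.adicCompletion K)))
    (a : v.adicCompletionIntegers K) (k : ℕ) :
    φ a ∈ IsLocalRing.maximalIdeal (Valuation.valuationSubring (Valuation.comap (algebraMap (maxUnramified (v.adicCompletion K)) (AlgebraicClosure (v.adicCompletion K))) w)) ^ k ↔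
      a ∈ IsLocalRing.maximalIdeal (v.adicCompletionIntegers K) ^ k := by
  obtain ⟨ϖ, hϖ⟩ := IsDiscreteValuationRing.exists_irreducible (v.adicCompletionIntegers K)
  rw [mem_maximalIdeal_unrIntegers_pow_iff hw hϖ, mem_maximalIdeal_adicCompletionIntegers_pow_iff hw hϖ,
    hφ]

/-- Transfer of membership in the maximal ideal along `𝓞_v → 𝒪ⁿʳ`. [folklore] -/
theorem map_mem_maximalIdeal_iff {φ : v.adicCompletionIntegers K →+* (Valuation.valuationSubring (Valuation.comap (algebraMap (maxUnramified (v.adicCompletion K)) (AlgebraicClosure (v.adicCompletion K))) w))}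
    (hφ : ∀ a, (((φ a : (Valuation.valuationSubring (Valuation.comap (algebraMap (maxUnramified (v.adicCompletion K)) (AlgebraicClosure (v.adicCompletion K))) w))) : (maxUnramified (v.adicCompletion K))) : (AlgebraicClosure (v.adicCompletion K))) = algebraMap (v.adicCompletion K) (AlgebraicClosure (v.adicCompletion K)) (a : (v.adicCompletion K)))
    (a : v.adicCompletionIntegers K) :
    φ a ∈ IsLocalRing.maximalIdeal (Valuation.valuationSubring (Valuation.comap (algebraMap (maxUnramified (v.adicCompletion K)) (AlgebraicClosure (v.adicCompletion K))) w)) ↔ a ∈ IsLocalRing.maximalIdeal (v.adicCompletionIntegers K) := by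
  simpa only [pow_one] using map_mem_maximalIdeal_pow_iff hw hφ a 1

/-- Transfer of units along `𝓞_v → 𝒪ⁿʳ`. [folklore] -/
theorem isUnit_map_iff {φ : v.adicCompletionIntegers K →+* (Valuation.valuationSubring (Valuation.comap (algebraMap (maxUnramified (v.adicCompletion K)) (AlgebraicClosure (v.adicCompletion K))) w))}
    (hφ : ∀ a, (((φ a : (Valuation.valuationSubring (Valuation.comap (algebraMap (maxUnramified (v.adicCompletion K)) (AlgebraicClosure (v.adicCompletion K))) w))) : (maxUnramified (v.adicCompletion K))) : (AlgebraicClosure (v.adicCompletion K))) = algebraMap (v.adicCompletion K) (AlgebraicClosure (v.adicCompletion K)) (a : (v.adicCompletion K)))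
    (a : v.adicCompletionIntegers K) : IsUnit (φ a) ↔ IsUnit a := by
  rw [← not_iff_not, ← mem_nonunits_iff, ← mem_nonunits_iff, ← IsLocalRing.mem_maximalIdeal,
    ← IsLocalRing.mem_maximalIdeal]
  exact map_mem_maximalIdeal_iff hw hφ a



/-- A uniformiser of `𝓞_v` stays irreducible in `𝒪ⁿʳ` under the structure map. [folklore] -/
theorem irreducible_map_of_coe_eq_algebraMap {φ : v.adicCompletionIntegers K →+* (Valuation.valuationSubring (Valuation.comap (algebraMap (maxUnramified (v.adicCompletion K)) (AlgebraicClosure (v.adicCompletion K))) w))}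
    (hφ : ∀ a, (((φ a : (Valuation.valuationSubring (Valuation.comap (algebraMap (maxUnramified (v.adicCompletion K)) (AlgebraicClosure (v.adicCompletion K))) w))) : (maxUnramified (v.adicCompletion K))) : (AlgebraicClosure (v.adicCompletion K))) = algebraMap (v.adicCompletion K) (AlgebraicClosure (v.adicCompletion K)) (a : (v.adicCompletion K)))
    {ϖ : v.adicCompletionIntegers K} (hϖ : Irreducible ϖ) : Irreducible (φ ϖ) :=
  irreducible_unrIntegers_of_coe_eq hw hϖ (hφ ϖ)

omit hw in
/-- The embedding `𝒪ⁿʳ → 𝒪_w` detects the maximal ideals (`|x| < 1` on both sides). [folklore] -/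
theorem map_mem_maximalIdeal_integer_iff {ψ : (Valuation.valuationSubring (Valuation.comap (algebraMap (maxUnramified (v.adicCompletion K)) (AlgebraicClosure (v.adicCompletion K))) w)) →+* w.integer}
    (hψ : ∀ x : (Valuation.valuationSubring (Valuation.comap (algebraMap (maxUnramified (v.adicCompletion K)) (AlgebraicClosure (v.adicCompletion K))) w)), ((ψ x : w.integer) : (AlgebraicClosure (v.adicCompletion K))) = ((x : (maxUnramified (v.adicCompletion K))) : (AlgebraicClosure (v.adicCompletion K)))) (x : (Valuation.valuationSubring (Valuation.comap (algebraMap (maxUnramified (v.adicCompletion K)) (AlgebraicClosure (v.adicCompletion K))) w))) :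
    ψ x ∈ IsLocalRing.maximalIdeal w.integer ↔ x ∈ IsLocalRing.maximalIdeal (Valuation.valuationSubring (Valuation.comap (algebraMap (maxUnramified (v.adicCompletion K)) (AlgebraicClosure (v.adicCompletion K))) w)) := by
  rw [mem_maximalIdeal_unrIntegers_iff, ← IsLocalRing.residue_eq_zero_iff,
    ← v_algebraMap_lt_one_iff (Valuation.integer.integers w), ← hψ x]
  rfl

omit hw in
/-- The embedding `𝒪ⁿʳ → 𝒪_w` is injective. [folklore] -/
theorem injective_of_coe_eq_coe {ψ : (Valuation.valuationSubring (Valuation.comap (algebraMap (maxUnramified (v.adicCompletion K)) (AlgebraicClosure (v.adicCompletion K))) w)) →+* w.integer}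
    (hψ : ∀ x : (Valuation.valuationSubring (Valuation.comap (algebraMap (maxUnramified (v.adicCompletion K)) (AlgebraicClosure (v.adicCompletion K))) w)), ((ψ x : w.integer) : (AlgebraicClosure (v.adicCompletion K))) = ((x : (maxUnramified (v.adicCompletion K))) : (AlgebraicClosure (v.adicCompletion K)))) : Function.Injective ψ :=
  fun x y hxy ↦ by
    have h1 : ((x : (maxUnramified (v.adicCompletion K))) : (AlgebraicClosure (v.adicCompletion K))) = ((y : (maxUnramified (v.adicCompletion K))) : (AlgebraicClosure (v.adicCompletion K))) := by rw [← hψ, ← hψ, hxy]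
    exact Subtype.ext (Subtype.ext h1)

end IsDedekindDomain.HeightOneSpectrum

end
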